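import Mathlib
import Summits.Ventures.PercRepro2.HCov
import Summits.Ventures.PercRepro2.HCovTyped
import Summits.Ventures.PercRepro2.TypedUnmarkedCount
import Summits.Ventures.PercRepro2.TypedSixVertex
import Summits.Ventures.PercRepro2.GcSkelRules
import Summits.Ventures.PercRepro2.GcSkelReductionMinH
import Summits.Ventures.PercRepro2.GcInterior
import Summits.Ventures.PercRepro2.GcRational

/-!
# At most one active unmarked vertex ⟹ (HCOV); the clause «two active unmarked vertices»
(blind cell PercRepro2, typer-1 g55)

mine-2 g42's `typedCount_nonneg_of_unmarked_le_one` (TypedSixVertex p702957) is row 2′TRI on every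
instance whose typed edges touch at most one vertex outside the marks. Loops are invisible to `Gc`
(`Gc_eq_of_agree_nonLoop`), so after moving every loop to `o` a graph with at most one ACTIVE
unmarked vertex (one carrying a non-loop edge) has every typed set touching at most one unmarked
vertex, and (HCOV) follows at every weight — a class theorem on `(ends, marks)`, hence one more
clause of the weighted residual, sharper than `6 < |V|` (isolated unmarked vertices do not count):

* `OneActiveUnmarked` — at most one unmarked vertex carries a non-loop edge;
* `relocateLoops` — every loop moved to `o`; `typedBases_of_oneActiveUnmarked`;
* **`HCov_of_oneActiveUnmarked`** — the class theorem, every admissible weight;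
* **`WReducedMinHA`** := `WReducedMinH` ∧ ¬`OneActiveUnmarked` (two active unmarked vertices),
  the closures `HCovWRedMinHA_all` / `HCovWRedMinHA_int_all`, **`HCov_all_iff_HCovWRedMinHA_all`**,
  **`HCov_all_iff_HCovWRedMinHA_int_all`**, **`HCov_all_real_iff_HCovWRedMinHA_int_all_rat`** —
  THE STATEMENT OF RECORD: the crux over `ℝ` is (HCOV) on the class of record with at least two
  active unmarked vertices, at rational interior weights.
-/

namespace Summit.Ventures.PercRepro2

open CovForm RECM

namespace WRed

/-! ## The class -/

section Class

variable {V : Type*} {E : Type*}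

/-- **At most one active unmarked vertex**: two unmarked vertices each carrying a non-loop edge
coincide. -/
def OneActiveUnmarked (ends : E → Sym2 V) (o a₁ a₂ a₃ b : V) : Prop :=
  ∀ x y : V, Unmarked o a₁ a₂ a₃ b x → Unmarked o a₁ a₂ a₃ b y →
    (∃ e, x ∈ ends e ∧ ¬ (ends e).IsDiag) → (∃ e, y ∈ ends e ∧ ¬ (ends e).IsDiag) → x = y

variable [DecidableEq V]

/-- Every loop moved to `o`. -/
def relocateLoops (ends : E → Sym2 V) (o : V) : E → Sym2 V :=
  fun e => if (ends e).IsDiag then s(o, o) else ends e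

/-- The relocated map agrees with `ends` on every non-loop edge of `ends`. -/
lemma relocateLoops_agree (ends : E → Sym2 V) (o : V) :
    ∀ g, ¬ (ends g).IsDiag → relocateLoops ends o g = ends g := by
  intro g hg
  simp [relocateLoops, hg]

/-- The relocated map agrees with `ends` on every non-loop edge of the relocated map. -/
lemma relocateLoops_agree' (ends : E → Sym2 V) (o : V) :
    ∀ g, ¬ (relocateLoops ends o g).IsDiag → relocateLoops ends o g = ends g := by
  intro g hg
  by_cases h : (ends g).IsDiag
  · exfalso
    apply hg
    simp [relocateLoops, h]
  · simp [relocateLoops, h]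

/-- A vertex of an edge of the relocated map is `o` or an end of a non-loop edge of `ends`. -/
lemma mem_relocateLoops {ends : E → Sym2 V} {o : V} {e : E} {v : V}
    (hv : v ∈ relocateLoops ends o e) : v = o ∨ (v ∈ ends e ∧ ¬ (ends e).IsDiag) := by
  by_cases h : (ends e).IsDiag
  · left
    simp only [relocateLoops, h, if_true, Sym2.mem_iff, or_self] at hv
    exact hv
  · right
    simp only [relocateLoops, h, if_false] at hv
    exact ⟨hv, h⟩

end Class

/-! ## The class theorem -/

section Theorem

variable {V : Type*} {E : Type*} [Fintype V] [DecidableEq V] [Fintype E] [DecidableEq E]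
  {R : Type*} [Field R] [LinearOrder R] [IsStrictOrderedRing R]

omit [Fintype E] [DecidableEq E] in
/-- On the relocated map every typed set touches at most one unmarked vertex. -/
lemma unmarkedTyped_card_le_one_of_oneActive {ends : E → Sym2 V} {o a₁ a₂ a₃ b : V}
    (h : OneActiveUnmarked ends o a₁ a₂ a₃ b) (F : Finset E) :
    (TypedRed.unmarkedTyped (relocateLoops ends o) o a₁ a₂ a₃ b F).card ≤ 1 := by
  rw [Finset.card_le_one]
  intro x hx y hy
  rw [TypedRed.mem_unmarkedTyped] at hx hy
  obtain ⟨⟨ex, _, hxe⟩, hxo, hx1, hx2, hx3, hxb⟩ := hx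
  obtain ⟨⟨ey, _, hye⟩, hyo, hy1, hy2, hy3, hyb⟩ := hy
  rcases mem_relocateLoops hxe with hx' | hx'
  · exact absurd hx' hxo
  rcases mem_relocateLoops hye with hy' | hy'
  · exact absurd hy' hyo
  exact h x y ⟨hxo, hx1, hx2, hx3, hxb⟩ ⟨hyo, hy1, hy2, hy3, hyb⟩ ⟨ex, hx'⟩ ⟨ey, hy'⟩

/-- Row 2′TRI on the relocated map of a graph with at most one active unmarked vertex. -/
theorem typedBases_of_oneActiveUnmarked {ends : E → Sym2 V} {o a₁ a₂ a₃ b : V}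
    (h : OneActiveUnmarked ends o a₁ a₂ a₃ b) :
    TypedBases (R := R) (relocateLoops ends o) o a₁ a₂ a₃ b := by
  intro F z τ hτ
  exact TypedRed.typedCount_nonneg_of_unmarked_le_one (relocateLoops ends o) o a₁ a₂ a₃ b F z τ hτ
    (unmarkedTyped_card_le_one_of_oneActive h F)

/-- **(HCOV) on every graph with at most one active unmarked vertex**, every admissible weight. -/
theorem HCov_of_oneActiveUnmarked {ends : E → Sym2 V} {o a₁ a₂ a₃ b : V}
    (h : OneActiveUnmarked ends o a₁ a₂ a₃ b) (p : E → R) (hp : IsProbVec p) :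
    HCov p ends o a₁ a₂ a₃ b := by
  have h' := HCov_of_typedBases (relocateLoops ends o) o a₁ a₂ a₃ b
    (typedBases_of_oneActiveUnmarked (R := R) h) p hp
  unfold HCov at h' ⊢
  rw [Gc_eq_of_agree_nonLoop p (relocateLoops_agree ends o) (relocateLoops_agree' ends o)]
  exact h'

end Theorem

/-! ## The clause -/

section ClassA

variable {V : Type*} {E : Type*} [Fintype E] [DecidableEq E] [DecidableEq V]

/-- **The class of record with two active unmarked vertices**: `WReducedMinH` and not
`OneActiveUnmarked`. -/
structure WReducedMinHA (ends : E → Sym2 V) (o a₁ a₂ a₃ b : V) : Prop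
    extends WReducedMinH ends o a₁ a₂ a₃ b where
  /-- at least two unmarked vertices carry a non-loop edge -/
  twoActive : ¬ OneActiveUnmarked ends o a₁ a₂ a₃ b

end ClassA

section Closure

variable (R : Type*) [Field R] [LinearOrder R] [IsStrictOrderedRing R]

/-- **(HCOV) on the class of record with two active unmarked vertices.** -/
def HCovWRedMinHA_all : Prop :=
  ∀ (V E : Type) [Fintype V] [DecidableEq V] [Fintype E] [DecidableEq E]
    (ends : E → Sym2 V) (p : E → R), IsProbVec p →
    ∀ o a₁ a₂ a₃ b : V, a₁ ≠ a₂ → a₁ ≠ a₃ → a₂ ≠ a₃ → o ≠ a₁ → o ≠ a₂ → o ≠ a₃ → o ≠ b →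
      b ≠ a₁ → b ≠ a₂ → b ≠ a₃ → WReducedMinHA ends o a₁ a₂ a₃ b → HCov p ends o a₁ a₂ a₃ b

/-- **(HCOV) on the class of record with two active unmarked vertices, at interior weights.** -/
def HCovWRedMinHA_int_all : Prop :=
  ∀ (V E : Type) [Fintype V] [DecidableEq V] [Fintype E] [DecidableEq E]
    (ends : E → Sym2 V) (p : E → R), IsIntVec p →
    ∀ o a₁ a₂ a₃ b : V, a₁ ≠ a₂ → a₁ ≠ a₃ → a₂ ≠ a₃ → o ≠ a₁ → o ≠ a₂ → o ≠ a₃ → o ≠ b →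
      b ≠ a₁ → b ≠ a₂ → b ≠ a₃ → WReducedMinHA ends o a₁ a₂ a₃ b → HCov p ends o a₁ a₂ a₃ b

end Closure

section Main

variable {R : Type*} [Field R] [LinearOrder R] [IsStrictOrderedRing R]

/-- The class theorem folded: `by_cases` on the class. -/
theorem HCovWRedMinH_all_of_HCovWRedMinHA_all (h : HCovWRedMinHA_all R) : HCovWRedMinH_all R := by
  intro V E _ _ _ _ ends p hp o a₁ a₂ a₃ b h12 h13 h23 ho1 ho2 ho3 hob hb1 hb2 hb3 hred
  by_cases hone : OneActiveUnmarked ends o a₁ a₂ a₃ b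
  · exact HCov_of_oneActiveUnmarked hone p hp
  · exact h V E ends p hp o a₁ a₂ a₃ b h12 h13 h23 ho1 ho2 ho3 hob hb1 hb2 hb3 ⟨hred, hone⟩

/-- The two closures agree. -/
theorem HCovWRedMinH_all_iff_HCovWRedMinHA_all : HCovWRedMinH_all R ↔ HCovWRedMinHA_all R :=
  ⟨fun h V E _ _ _ _ ends p hp o a₁ a₂ a₃ b h12 h13 h23 ho1 ho2 ho3 hob hb1 hb2 hb3 hred =>
      h V E ends p hp o a₁ a₂ a₃ b h12 h13 h23 ho1 ho2 ho3 hob hb1 hb2 hb3 hred.toWReducedMinH,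
    HCovWRedMinH_all_of_HCovWRedMinHA_all⟩

/-- **THE CRUX ON THE CLASS OF RECORD WITH TWO ACTIVE UNMARKED VERTICES**:
`HCov_all ↔ HCovWRedMinHA_all`. -/
theorem HCov_all_iff_HCovWRedMinHA_all : HCov_all R ↔ HCovWRedMinHA_all R :=
  HCov_all_iff_HCovWRedMinH_all.trans HCovWRedMinH_all_iff_HCovWRedMinHA_all

/-- The interior closure gives the closure (`HCov_of_int`). -/
theorem HCovWRedMinHA_all_of_int (h : HCovWRedMinHA_int_all R) : HCovWRedMinHA_all R := by
  intro V E _ _ _ _ ends p hp o a₁ a₂ a₃ b h12 h13 h23 ho1 ho2 ho3 hob hb1 hb2 hb3 hred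
  exact HCov_of_int ends o a₁ a₂ a₃ b
    (fun q hq => h V E ends q hq o a₁ a₂ a₃ b h12 h13 h23 ho1 ho2 ho3 hob hb1 hb2 hb3 hred) p hp

/-- The two closures agree. -/
theorem HCovWRedMinHA_all_iff_int : HCovWRedMinHA_all R ↔ HCovWRedMinHA_int_all R :=
  ⟨fun h V E _ _ _ _ ends p hp o a₁ a₂ a₃ b h12 h13 h23 ho1 ho2 ho3 hob hb1 hb2 hb3 hred =>
      h V E ends p hp.isProbVec o a₁ a₂ a₃ b h12 h13 h23 ho1 ho2 ho3 hob hb1 hb2 hb3 hred,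
    HCovWRedMinHA_all_of_int⟩

/-- **THE CRUX ON THE CLASS OF RECORD WITH TWO ACTIVE UNMARKED VERTICES, AT INTERIOR WEIGHTS**:
`HCov_all ↔ HCovWRedMinHA_int_all`. -/
theorem HCov_all_iff_HCovWRedMinHA_int_all : HCov_all R ↔ HCovWRedMinHA_int_all R :=
  HCov_all_iff_HCovWRedMinHA_all.trans HCovWRedMinHA_all_iff_int

end Main

section Real

/-- **THE STATEMENT OF RECORD**: the crux over `ℝ` is (HCOV) on the class of record with at least
two active unmarked vertices, at rational weights in `(0, 1)^E`. -/
theorem HCov_all_real_iff_HCovWRedMinHA_int_all_rat : HCov_all ℝ ↔ HCovWRedMinHA_int_all ℚ :=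
  HCov_all_real_iff_rat.trans (HCov_all_iff_HCovWRedMinHA_int_all (R := ℚ))

end Real

end WRed

end Summit.Ventures.PercRepro2
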